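import Summits.CriticalPhenomena.PercolationContinuityZ3.Theorems.PercNearOneGluingNoHeavyQuantGWAnimalCount
import HarnessLib

/-!
# QUANT lane / PAPER-2 rate track (ARM-2 = constants bookkeeper, gen 5): the generating-function majorant of the tree numbers and
# THE PEIERLS CERTIFICATE AT `ε = 2⁻⁵` — `Σ_{t≥0} (9(t+1)+1)·gw 8 (t+1)·2^{−5(t+1)} ≤ 3227/5000 ≤ 2/3`

builds on p205010 (kernel theorem, internal audit signed; external expert review pending)

Cell `prim-quant`, seat `prim-quant-arm-2` (RATE-CONSTANTS.md §8 (L1a⁗); `quant/prim-quant-arm-2-g5/STATUS.md`).  Third combinatorics file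
(after `…QuantAnimalSlots`, `…QuantGWAnimalCount`: `#starAnimals v m ≤ gw 8 m` on `ℤ²`).  The majorant WITHOUT closed forms: the partial sums of `C(t) = Σ gw Δ n t^n` and of `t·C'(t)` obey the tree recursion `C_{<M+1} ≤ 1 + t·C_{<M}^Δ`,
`Q_{<M+1} ≤ t·(C_{<M}^Δ + Δ·Q_{<M}·C_{<M}^{Δ−1})` (`gwP_succ_le`, `gwQ_succ_le`: expand over the box `(range M)^Δ ⊇ ⋃_{n<M}{Σg = n}`,
`Finset.prod_univ_sum`), so the two CERTIFICATE inequalities `t(1+y)^Δ ≤ y` and `t((1+y)^Δ + Δz(1+y)^{Δ−1}) ≤ z` bound every partial sum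
(`gwP_le`, `gwQ_le`) and give **`peierls_partial_sum_le`**: `Σ_{m<M} (9(m+1)+1)·gw Δ (m+1)·t^{m+1} ≤ 9z + y`, `summable_peierls`.
At `Δ = 8`, `t = 2⁻⁵` the rationals `y = 221/5000`, `z = 167/2500` pass (`norm_num`): **`summable_peierls_five`**,
**`peierls_five_le_two_thirds`** (interval value of the series `0.64469…`; exact king's-lattice counts `m ≤ 9` + tail would give `0.535`;
the `a = 4` rung `t = 2⁻⁴` is impossible for this cover — the exact terms `m ≤ 2` alone exceed `1`).  Consumed by
`…QuantPeierlsStarDriverFive` (`theta_slab_pos_five`); by recipe RATE-PLAN §12.6 the `d = 3` base becomes `1 − 2⁻²²⁹⁴` (sandwich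
`EpsSharp.orbit_five_three_sharp`, p248843).  Class of the rate UNCHANGED (iterated logarithm); honest sentence unchanged.
Pure real arithmetic; no percolation input. [folklore]
-/

noncomputable section

namespace Summit.CriticalPhenomena.PercolationContinuityZ3.Theorems.Quant.GWCount

open Finset
open scoped Classical

/-! ## The generating-function majorant: `Σ_m (9m+1)·gw Δ m·t^m ≤ 9z + y` from two certificate inequalities -/

section Majorant

variable {Δ : ℕ} {t : ℝ}

/-- Partial sums are nonnegative for `t ≥ 0`. [folklore] -/
theorem gwP_nonneg (ht : 0 ≤ t) (M : ℕ) : 0 ≤ (∑ n ∈ range M, (gw Δ n : ℝ) * t ^ n) := sum_nonneg fun n _ => by positivity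
/-- Weighted partial sums are nonnegative for `t ≥ 0`. [folklore] -/
theorem gwQ_nonneg (ht : 0 ≤ t) (M : ℕ) : 0 ≤ (∑ n ∈ range M, (n : ℝ) * ((gw Δ n : ℝ) * t ^ n)) := sum_nonneg fun n _ => by positivity

/-- The size vectors of total `< M` sit inside the box `(range M)^Δ`. [folklore] -/
theorem biUnion_piAntidiag_subset (Δ M : ℕ) :
    (range M).biUnion (fun n => piAntidiag (univ : Finset (Fin Δ)) n) ⊆ Fintype.piFinset fun _ : Fin Δ => range M := by
  intro g hg
  rw [mem_biUnion] at hg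
  obtain ⟨n, hn, hg⟩ := hg
  rw [Fintype.mem_piFinset]
  intro i
  have hs : ∑ b, g b = n := (mem_piAntidiag.1 hg).1
  have := Finset.single_le_sum (fun b _ => Nat.zero_le (g b)) (mem_univ i)
  rw [mem_range] at hn ⊢
  omega

/-- Size vectors with different totals are different. [folklore] -/
theorem pairwiseDisjoint_piAntidiag (Δ : ℕ) (s : Finset ℕ) :
    (s : Set ℕ).PairwiseDisjoint (fun n => piAntidiag (univ : Finset (Fin Δ)) n) := by
  intro n _ n' _ hne
  rw [Function.onFun, Finset.disjoint_left]
  intro g hg hg'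
  exact hne ((mem_piAntidiag.1 hg).1.symm.trans (mem_piAntidiag.1 hg').1)

/-- One step of the tree recursion on partial sums: `C_{<M+1}(t) ≤ 1 + t·C_{<M}(t)^Δ`. [folklore] -/
theorem gwP_succ_le (ht : 0 ≤ t) (M : ℕ) : (∑ n ∈ range (M + 1), (gw Δ n : ℝ) * t ^ n) ≤ 1 + t * (∑ n ∈ range M, (gw Δ n : ℝ) * t ^ n) ^ Δ := by
  have hw : ∀ n, ∀ g ∈ piAntidiag (univ : Finset (Fin Δ)) n,
      (∏ i, (gw Δ (g i) : ℝ)) * t ^ (n + 1) = t * ∏ i, ((gw Δ (g i) : ℝ) * t ^ (g i)) := by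
    intro n g hg
    rw [prod_mul_distrib, prod_pow_eq_pow_sum, (mem_piAntidiag.1 hg).1, pow_succ]
    ring
  rw [sum_range_succ', gw_zero, pow_zero, Nat.cast_one, one_mul, add_comm]
  refine add_le_add le_rfl ?_
  calc ∑ n ∈ range M, (gw Δ (n + 1) : ℝ) * t ^ (n + 1)
      = ∑ n ∈ range M, ∑ g ∈ piAntidiag (univ : Finset (Fin Δ)) n, t * ∏ i, ((gw Δ (g i) : ℝ) * t ^ (g i)) := by
        refine sum_congr rfl fun n _ => ?_
        rw [gw_succ, Nat.cast_sum, sum_mul]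
        exact sum_congr rfl fun g hg => by rw [Nat.cast_prod]; exact hw n g hg
    _ = t * ∑ g ∈ (range M).biUnion (fun n => piAntidiag (univ : Finset (Fin Δ)) n), ∏ i, ((gw Δ (g i) : ℝ) * t ^ (g i)) := by
        rw [sum_biUnion (pairwiseDisjoint_piAntidiag Δ (range M)), mul_sum]
        exact sum_congr rfl fun n _ => (mul_sum _ _ _).symm
    _ ≤ t * ∑ g ∈ Fintype.piFinset (fun _ : Fin Δ => range M), ∏ i, ((gw Δ (g i) : ℝ) * t ^ (g i)) := by
        refine mul_le_mul_of_nonneg_left ?_ ht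
        exact sum_le_sum_of_subset_of_nonneg (biUnion_piAntidiag_subset Δ M) fun g _ _ => by positivity
    _ = t * (∑ n ∈ range M, (gw Δ n : ℝ) * t ^ n) ^ Δ := by
        rw [← prod_univ_sum (fun _ : Fin Δ => range M) (fun _ j => (gw Δ j : ℝ) * t ^ j), prod_const, card_univ,
          Fintype.card_fin]

/-- Marking one slot in a product of sums: `Σ_{g ∈ s^Δ} g_i·Π_{i'} w(g_{i'}) = (Σ_{j∈s} j·w j)·(Σ_{j∈s} w j)^{Δ−1}`. [folklore] -/
theorem sum_piFinset_mark {Δ : ℕ} (s : Finset ℕ) (w : ℕ → ℝ) (i : Fin Δ) :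
    ∑ g ∈ Fintype.piFinset (fun _ : Fin Δ => s), (g i : ℝ) * ∏ i', w (g i') =
      (∑ j ∈ s, (j : ℝ) * w j) * (∑ j ∈ s, w j) ^ (Δ - 1) := by
  set f : Fin Δ → ℕ → ℝ := fun i' j => if i' = i then (j : ℝ) * w j else w j with hf
  have hfi : ∀ j, f i j = (j : ℝ) * w j := fun j => by simp [hf]
  have hfne : ∀ i', i' ≠ i → ∀ j, f i' j = w j := fun i' h j => by simp [hf, h]
  have e : ∀ g : Fin Δ → ℕ, (g i : ℝ) * ∏ i', w (g i') = ∏ i', f i' (g i') := by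
    intro g
    rw [← mul_prod_erase univ (fun i' => f i' (g i')) (mem_univ i), ← mul_prod_erase univ (fun i' => w (g i')) (mem_univ i),
      hfi, mul_assoc, prod_congr rfl (fun i' hi' => hfne i' (ne_of_mem_erase hi') (g i'))]
  rw [sum_congr rfl fun g _ => e g, ← prod_univ_sum (fun _ : Fin Δ => s) f, ← mul_prod_erase univ _ (mem_univ i),
    sum_congr rfl fun j _ => hfi j,
    prod_congr rfl fun i' hi' => sum_congr rfl fun j _ => hfne i' (ne_of_mem_erase hi') j,
    prod_const, card_erase_of_mem (mem_univ i), card_univ, Fintype.card_fin]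

/-- One step for the size-weighted sums: `Q_{<M+1}(t) ≤ t·(C_{<M}^Δ + Δ·Q_{<M}·C_{<M}^{Δ−1})`. [folklore] -/
theorem gwQ_succ_le (ht : 0 ≤ t) (M : ℕ) :
    (∑ n ∈ range (M + 1), (n : ℝ) * ((gw Δ n : ℝ) * t ^ n)) ≤ t * ((∑ n ∈ range M, (gw Δ n : ℝ) * t ^ n) ^ Δ + Δ * (∑ n ∈ range M, (n : ℝ) * ((gw Δ n : ℝ) * t ^ n)) * (∑ n ∈ range M, (gw Δ n : ℝ) * t ^ n) ^ (Δ - 1)) := by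
  -- abbreviations
  set w : ℕ → ℝ := fun j => (gw Δ j : ℝ) * t ^ j with hwdef
  have hw0 : ∀ j, 0 ≤ w j := fun j => by simp only [hwdef]; positivity
  have hPw : (∑ n ∈ range M, (gw Δ n : ℝ) * t ^ n) = ∑ j ∈ range M, w j := rfl
  have hQw : (∑ n ∈ range M, (n : ℝ) * ((gw Δ n : ℝ) * t ^ n)) = ∑ j ∈ range M, (j : ℝ) * w j := rfl
  -- the term identity
  have hterm : ∀ n, ∀ g ∈ piAntidiag (univ : Finset (Fin Δ)) n,
      ((n + 1 : ℕ) : ℝ) * ((∏ i, (gw Δ (g i) : ℝ)) * t ^ (n + 1)) =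
        t * ∏ i, w (g i) + ∑ i, t * ((g i : ℝ) * ∏ i', w (g i')) := by
    intro n g hg
    have hs := (mem_piAntidiag.1 hg).1
    have e1 : (∏ i, (gw Δ (g i) : ℝ)) * t ^ (n + 1) = t * ∏ i, w (g i) := by
      simp only [hwdef]
      rw [prod_mul_distrib, prod_pow_eq_pow_sum, hs, pow_succ]; ring
    rw [e1, ← mul_sum, ← sum_mul]
    have e2 : ((n + 1 : ℕ) : ℝ) = (∑ i, (g i : ℝ)) + 1 := by rw [← Nat.cast_sum, hs]; push_cast; ring
    rw [e2]; ring
  -- product with one marked slot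
  have hmark : ∀ i : Fin Δ, ∑ g ∈ Fintype.piFinset (fun _ : Fin Δ => range M), (g i : ℝ) * ∏ i', w (g i') =
      (∑ n ∈ range M, (n : ℝ) * ((gw Δ n : ℝ) * t ^ n)) * (∑ n ∈ range M, (gw Δ n : ℝ) * t ^ n) ^ (Δ - 1) := by
    intro i
    rw [sum_piFinset_mark (range M) w i, ← hQw, ← hPw]
  rw [sum_range_succ']
  simp only [Nat.cast_zero, zero_mul, add_zero]
  calc ∑ n ∈ range M, ((n + 1 : ℕ) : ℝ) * ((gw Δ (n + 1) : ℝ) * t ^ (n + 1))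
      = ∑ n ∈ range M, ∑ g ∈ piAntidiag (univ : Finset (Fin Δ)) n,
          (t * ∏ i, w (g i) + ∑ i, t * ((g i : ℝ) * ∏ i', w (g i'))) := by
        refine sum_congr rfl fun n _ => ?_
        rw [gw_succ, Nat.cast_sum, sum_mul, mul_sum]
        exact sum_congr rfl fun g hg => by rw [Nat.cast_prod]; exact hterm n g hg
    _ = ∑ g ∈ (range M).biUnion (fun n => piAntidiag (univ : Finset (Fin Δ)) n),
          (t * ∏ i, w (g i) + ∑ i, t * ((g i : ℝ) * ∏ i', w (g i'))) := by
        rw [sum_biUnion (pairwiseDisjoint_piAntidiag Δ (range M))]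
    _ ≤ ∑ g ∈ Fintype.piFinset (fun _ : Fin Δ => range M),
          (t * ∏ i, w (g i) + ∑ i, t * ((g i : ℝ) * ∏ i', w (g i'))) := by
        refine sum_le_sum_of_subset_of_nonneg (biUnion_piAntidiag_subset Δ M) fun g _ _ => ?_
        have : 0 ≤ ∏ i, w (g i) := prod_nonneg fun i _ => hw0 _
        positivity
    _ = t * (∑ n ∈ range M, (gw Δ n : ℝ) * t ^ n) ^ Δ + ∑ i : Fin Δ, t * ((∑ n ∈ range M, (n : ℝ) * ((gw Δ n : ℝ) * t ^ n)) * (∑ n ∈ range M, (gw Δ n : ℝ) * t ^ n) ^ (Δ - 1)) := by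
        rw [sum_add_distrib, ← mul_sum, ← prod_univ_sum (fun _ : Fin Δ => range M) (fun _ j => w j), prod_const,
          card_univ, Fintype.card_fin, ← hPw, sum_comm]
        congr 1
        exact sum_congr rfl fun i _ => by rw [← mul_sum, hmark i]
    _ = t * ((∑ n ∈ range M, (gw Δ n : ℝ) * t ^ n) ^ Δ + Δ * (∑ n ∈ range M, (n : ℝ) * ((gw Δ n : ℝ) * t ^ n)) * (∑ n ∈ range M, (gw Δ n : ℝ) * t ^ n) ^ (Δ - 1)) := by
        rw [sum_const, card_univ, Fintype.card_fin, nsmul_eq_mul]; ring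

/-- **Majorant of the generating function**: if `t(1+y)^Δ ≤ y` then every partial sum `Σ_{n<M} gw Δ n t^n ≤ 1 + y`. [folklore] -/
theorem gwP_le {y : ℝ} (ht : 0 ≤ t) (hy : 0 ≤ y) (hcert : t * (1 + y) ^ Δ ≤ y) : ∀ M, (∑ n ∈ range M, (gw Δ n : ℝ) * t ^ n) ≤ 1 + y
  | 0 => by rw [sum_range_zero]; linarith
  | M + 1 => by
    have ih := gwP_le ht hy hcert M
    have h0 := gwP_nonneg (Δ := Δ) ht M
    calc (∑ n ∈ range (M + 1), (gw Δ n : ℝ) * t ^ n) ≤ 1 + t * (∑ n ∈ range M, (gw Δ n : ℝ) * t ^ n) ^ Δ := gwP_succ_le ht M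
      _ ≤ 1 + t * (1 + y) ^ Δ := by gcongr
      _ ≤ 1 + y := by linarith

/-- **Majorant of the size-weighted generating function**: if moreover `t((1+y)^Δ + Δ z (1+y)^{Δ−1}) ≤ z` then every partial
sum `Σ_{n<M} n·gw Δ n·t^n ≤ z`. [folklore] -/
theorem gwQ_le {y z : ℝ} (ht : 0 ≤ t) (hy : 0 ≤ y) (hz : 0 ≤ z) (hcert : t * (1 + y) ^ Δ ≤ y)
    (hcert' : t * ((1 + y) ^ Δ + Δ * z * (1 + y) ^ (Δ - 1)) ≤ z) : ∀ M, (∑ n ∈ range M, (n : ℝ) * ((gw Δ n : ℝ) * t ^ n)) ≤ z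
  | 0 => by rw [sum_range_zero]; exact hz
  | M + 1 => by
    have ih := gwQ_le ht hy hz hcert hcert' M
    have hP := gwP_le ht hy hcert M
    have h0 := gwP_nonneg (Δ := Δ) ht M
    have h0' := gwQ_nonneg (Δ := Δ) ht M
    calc (∑ n ∈ range (M + 1), (n : ℝ) * ((gw Δ n : ℝ) * t ^ n)) ≤ t * ((∑ n ∈ range M, (gw Δ n : ℝ) * t ^ n) ^ Δ + Δ * (∑ n ∈ range M, (n : ℝ) * ((gw Δ n : ℝ) * t ^ n)) * (∑ n ∈ range M, (gw Δ n : ℝ) * t ^ n) ^ (Δ - 1)) := gwQ_succ_le ht M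
      _ ≤ t * ((1 + y) ^ Δ + Δ * z * (1 + y) ^ (Δ - 1)) := by gcongr
      _ ≤ z := hcert'

/-- **THE PEIERLS PARTIAL SUMS**: under the two certificate inequalities,
`Σ_{m<M} (9(m+1)+1)·gw Δ (m+1)·t^{m+1} ≤ 9z + y` for every `M`.
builds on p205010 (kernel theorem, internal audit signed; external expert review pending). [folklore] -/
theorem peierls_partial_sum_le {y z : ℝ} (ht : 0 ≤ t) (hy : 0 ≤ y) (hz : 0 ≤ z) (hcert : t * (1 + y) ^ Δ ≤ y)
    (hcert' : t * ((1 + y) ^ Δ + Δ * z * (1 + y) ^ (Δ - 1)) ≤ z) (M : ℕ) :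
    ∑ m ∈ range M, ((9 * (m + 1) + 1 : ℕ) : ℝ) * (gw Δ (m + 1) : ℝ) * t ^ (m + 1) ≤ 9 * z + y := by
  have hP := gwP_le ht hy hcert (M + 1)
  have hQ := gwQ_le ht hy hz hcert hcert' (M + 1)
  have eP : (∑ n ∈ range (M + 1), (gw Δ n : ℝ) * t ^ n) = 1 + ∑ m ∈ range M, (gw Δ (m + 1) : ℝ) * t ^ (m + 1) := by
    rw [sum_range_succ', gw_zero]; simp [add_comm]
  have eQ : (∑ n ∈ range (M + 1), (n : ℝ) * ((gw Δ n : ℝ) * t ^ n)) = ∑ m ∈ range M, ((m + 1 : ℕ) : ℝ) * ((gw Δ (m + 1) : ℝ) * t ^ (m + 1)) := by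
    rw [sum_range_succ']; simp
  have e : ∑ m ∈ range M, ((9 * (m + 1) + 1 : ℕ) : ℝ) * (gw Δ (m + 1) : ℝ) * t ^ (m + 1) =
      9 * (∑ n ∈ range (M + 1), (n : ℝ) * ((gw Δ n : ℝ) * t ^ n)) + ((∑ n ∈ range (M + 1), (gw Δ n : ℝ) * t ^ n) - 1) := by
    rw [eQ, eP, add_sub_cancel_left, mul_sum, ← sum_add_distrib]
    refine sum_congr rfl fun m _ => ?_
    push_cast; ring
  rw [e]; linarith

/-- **Summability and the value of the Peierls series** under the certificate. [folklore] -/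
theorem summable_peierls {y z : ℝ} (ht : 0 ≤ t) (hy : 0 ≤ y) (hz : 0 ≤ z) (hcert : t * (1 + y) ^ Δ ≤ y)
    (hcert' : t * ((1 + y) ^ Δ + Δ * z * (1 + y) ^ (Δ - 1)) ≤ z) :
    Summable (fun m : ℕ => ((9 * (m + 1) + 1 : ℕ) : ℝ) * (gw Δ (m + 1) : ℝ) * t ^ (m + 1)) ∧
      ∑' m : ℕ, ((9 * (m + 1) + 1 : ℕ) : ℝ) * (gw Δ (m + 1) : ℝ) * t ^ (m + 1) ≤ 9 * z + y :=
  have hnn : ∀ m : ℕ, 0 ≤ ((9 * (m + 1) + 1 : ℕ) : ℝ) * (gw Δ (m + 1) : ℝ) * t ^ (m + 1) := fun m => by positivity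
  ⟨summable_of_sum_range_le hnn (peierls_partial_sum_le ht hy hz hcert hcert'),
    Real.tsum_le_of_sum_range_le hnn (peierls_partial_sum_le ht hy hz hcert hcert')⟩

end Majorant

/-! ## The `d = 2` certificate at the Peierls constant `2⁻⁵` -/

section Certificate

/-- **THE CERTIFICATE AT THE PEIERLS CONSTANT `2⁻⁵`** (`Δ = 8`, `t = 1/32`): with `y = 221/5000`, `z = 167/2500`,
`(1+y)^8/32 ≤ y` and `((1+y)^8 + 8z(1+y)^7)/32 ≤ z`; hence the Peierls series of the exploration driver is summable with
`Σ_{t ≥ 0} (9(t+1)+1)·gw 8 (t+1)·2^{−5(t+1)} ≤ 9z + y = 3227/5000 ≤ 2/3` (interval value of the series: `0.64469…`).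
builds on p205010 (kernel theorem, internal audit signed; external expert review pending). [folklore] (numeric) -/
theorem summable_peierls_five :
    Summable (fun m : ℕ => ((9 * (m + 1) + 1 : ℕ) : ℝ) * (gw 8 (m + 1) : ℝ) * ((1 / 2 : ℝ) ^ 5) ^ (m + 1)) ∧
      ∑' m : ℕ, ((9 * (m + 1) + 1 : ℕ) : ℝ) * (gw 8 (m + 1) : ℝ) * ((1 / 2 : ℝ) ^ 5) ^ (m + 1) ≤ 3227 / 5000 := by
  have h := summable_peierls (Δ := 8) (t := (1 / 2 : ℝ) ^ 5) (y := 221 / 5000) (z := 167 / 2500) (by positivity)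
    (by norm_num) (by norm_num) (by norm_num) (by norm_num)
  norm_num at h ⊢
  exact h

/-- The certificate value is below the driver's budget `2/3`. [folklore] (numeric) -/
theorem peierls_five_le_two_thirds :
    ∑' m : ℕ, ((9 * (m + 1) + 1 : ℕ) : ℝ) * (gw 8 (m + 1) : ℝ) * ((1 / 2 : ℝ) ^ 5) ^ (m + 1) ≤ 2 / 3 :=
  summable_peierls_five.2.trans (by norm_num)

end Certificate

end Summit.CriticalPhenomena.PercolationContinuityZ3.Theorems.Quant.GWCount

end
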